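import Summits.CriticalPhenomena.PercolationContinuityZ3.Theorems.PercNearOneGluingNoHeavyLowerTailSahiAbsorbedSaturation

/-!
# The DOUBLE normal form for Sahi's conjecture at the value level: saturated AND co-saturated families (every weight of mass one)

Support file (cell `prim-sahi`, seat `prim-sahi-typer` gen 28; `--supports stmt-CriticalPhenomena-4575`).  Pure proofs, no definitions, no `sorry`,
standard axioms.  Continues …`SahiAbsorbedSaturation` (typer gen 27).

Let `μ ≥ 0` be a weight of mass one on a finite partial order `α`, Sahi-positive at the orders `1, …, n+1`, and `U_0, …, U_{n+1}` up-sets.  Two value-level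
sign laws of lane P3 act on a member `U_i`:
* SIGN⁻ (`sahiE_cons_insert_le_of_not_mem`): adding a maximal non-element that lies outside some other member does not increase `E_{n+2}` — whence
  SATURATION (gen 27, `exists_saturated_le`): (S1) every maximal non-element of `U_i` lies in all `U_j`, `j ≠ i`;
* SIGN⁺ (`sahiE_cons_le_insert_of_mem`, unconditional): REMOVING from `U_i` a minimal element that lies in ALL other members does not increase `E_{n+2}`
  either (`sahiE_update_erase_le`), keeps up-sets, and keeps (S1) (`saturated_update_erase`).
Hence (`exists_biSaturated_le`) every family of up-sets is dominated by one that is saturated AND CO-SATURATED: (S2) no minimal element of `U_i` lies in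
`∩_{j≠i} U_j`.  In the coloured-antichain language of gen 27 (`U_i = α ∖ ↓N_i`, `N = ⊔ N_i` an antichain): every minimal element of `α ∖ ↓N_i` lies below a
point of `N` of another colour.  Consequences: `sahiPositive_of_biSaturated` (`C_{n+2}(μ)` from `C_{≤n+1}(μ)` and `E_{n+2} ≥ 0` on bi-saturated families),
`sahiPositive_of_colouring₂` (the coloured form), `sahiPositive_three_of_colouring₂` (order 3, every FKG weight, unconditional).  Measured effect of (S2) on
the pattern-level twin at `(d,n) = (3,3)`: 3 642 → 795 colour classes, at `(3,4)`: × 5.7 fewer (typer gen 27 memo §10(a)); at the value level on the cube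
`{0,1}^5` (restricted-growth colourings using all colours, seat count `code/typer-gen28/s2count.c`): order 3: 528 800 → 143 780, order 4: 703 905 → 331 985,
order 5: 436 266 → 273 861. [this work]
-/

namespace Summit.CriticalPhenomena.PercolationContinuityZ3.Theorems

open Finset Function Equiv
open Literature.Combinatorics.Sahi2008

namespace SahiAbsorbed

section BiSaturation

open scoped Classical

variable {α : Type*} [Fintype α] [PartialOrder α] {μ : α → ℝ} {n : ℕ}

omit [PartialOrder α] in
/-- **The SIGN⁺ step in an arbitrary slot**: removing from `U_i` a point `y ∈ U_i` that lies in every other member does not increase `E_{n+2}`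
(every weight `μ ≥ 0` of mass one; the members may be arbitrary finsets). [this work] -/
theorem sahiE_update_erase_le (hμ0 : ∀ x, 0 ≤ μ x) (hμ1 : ∑ x, μ x = 1) (U : Fin (n + 2) → Finset α) (i : Fin (n + 2)) {y : α}
    (hyi : y ∈ U i) (hy : ∀ j, j ≠ i → y ∈ U j) :
    sahiE μ (n + 2) (fun j => setInd (update U i ((U i).erase y) j)) ≤ sahiE μ (n + 2) (fun j => setInd (U j)) := by
  rw [← sahiE_comp_perm μ (n + 2) (swap 0 i) (fun j => setInd (update U i ((U i).erase y) j)),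
    ← sahiE_comp_perm μ (n + 2) (swap 0 i) (fun j => setInd (U j)),
    comp_swap_eq_cons (fun j => setInd (update U i ((U i).erase y) j)) i, comp_swap_eq_cons (fun j => setInd (U j)) i]
  have hne : ∀ k : Fin (n + 1), swap (0 : Fin (n + 2)) i k.succ ≠ i := by
    intro k h
    have h2 := congrArg (swap (0 : Fin (n + 2)) i) h
    rw [swap_apply_self, swap_apply_right] at h2
    exact Fin.succ_ne_zero k h2
  have htail : (fun k : Fin (n + 1) => setInd (update U i ((U i).erase y) (swap 0 i k.succ))) =
      fun k => setInd (U (swap 0 i k.succ)) := by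
    funext k; rw [update_of_ne (hne k)]
  rw [update_self, htail]
  have key := sahiE_cons_le_insert_of_mem hμ0 hμ1 ((U i).erase y) (fun k => U (swap 0 i k.succ)) (x := y)
    (notMem_erase y (U i)) (fun k => hy _ (hne k))
  rwa [insert_erase hyi] at key

omit [Fintype α] in
/-- Erasing a MINIMAL element of an up-set leaves an up-set. [this work] -/
theorem isUpperSet_erase_of_minimal (W : Finset α) {y : α} (hW : IsUpperSet (W : Set α)) (hmin : ∀ z, z < y → z ∉ W) :
    IsUpperSet ((W.erase y : Finset α) : Set α) := by
  intro a b hab ha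
  rw [mem_coe, mem_erase] at ha ⊢
  refine ⟨fun hby => ?_, hW hab ha.2⟩
  subst hby
  rcases eq_or_lt_of_le hab with h | h
  · exact ha.1 h
  · exact hmin a h ha.2

omit [Fintype α] in
/-- **(S1) survives the SIGN⁺ step**: erasing from `V_i` a minimal element that lies in all other members keeps the family saturated. [this work] -/
theorem saturated_update_erase (V : Fin (n + 2) → Finset α)
    (hsat : ∀ i j, i ≠ j → ∀ y, y ∉ V i → (∀ z, y < z → z ∈ V i) → y ∈ V j)
    (i : Fin (n + 2)) {y : α} (hyi : y ∈ V i) (hmin : ∀ z, z < y → z ∉ V i) (hy : ∀ j, j ≠ i → y ∈ V j) :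
    ∀ a b, a ≠ b → ∀ w, w ∉ update V i ((V i).erase y) a → (∀ z, w < z → z ∈ update V i ((V i).erase y) a) →
      w ∈ update V i ((V i).erase y) b := by
  intro a b hab w hwa hwmax
  by_cases ha : a = i
  · subst ha
    rw [update_self] at hwa hwmax
    rw [update_of_ne (Ne.symm hab)]
    by_cases hwy : w = y
    · subst hwy; exact hy b (Ne.symm hab)
    · have hwV : w ∉ V a := fun h => hwa (mem_erase.2 ⟨hwy, h⟩)
      exact hsat a b hab w hwV fun z hz => (mem_erase.1 (hwmax z hz)).2
  · rw [update_of_ne ha] at hwa hwmax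
    by_cases hb : b = i
    · subst hb
      rw [update_self, mem_erase]
      refine ⟨?_, hsat a b hab w hwa hwmax⟩
      rintro rfl
      exact hwa (hy a ha)
    · rw [update_of_ne hb]
      exact hsat a b hab w hwa hwmax

/-- **CO-SATURATION on top of saturation**: a saturated family of up-sets is dominated (no larger `E_{n+2}`) by a saturated family of up-sets in
which no minimal element of a member lies in all the other members (every weight `μ ≥ 0` of mass one). [this work] -/
theorem exists_coSaturated_le_of_saturated (hμ0 : ∀ x, 0 ≤ μ x) (hμ1 : ∑ x, μ x = 1) (V : Fin (n + 2) → Finset α)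
    (hV : ∀ i, IsUpperSet (V i : Set α)) (hsat : ∀ i j, i ≠ j → ∀ y, y ∉ V i → (∀ z, y < z → z ∈ V i) → y ∈ V j) :
    ∃ W : Fin (n + 2) → Finset α, (∀ i, IsUpperSet (W i : Set α)) ∧
      (∀ i j, i ≠ j → ∀ y, y ∉ W i → (∀ z, y < z → z ∈ W i) → y ∈ W j) ∧
      (∀ i, ∀ y ∈ W i, (∀ z, z < y → z ∉ W i) → ∃ j, j ≠ i ∧ y ∉ W j) ∧
      sahiE μ (n + 2) (fun i => setInd (W i)) ≤ sahiE μ (n + 2) (fun i => setInd (V i)) := by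
  suffices H : ∀ m (V : Fin (n + 2) → Finset α), ∑ i, (V i).card = m → (∀ i, IsUpperSet (V i : Set α)) →
      (∀ i j, i ≠ j → ∀ y, y ∉ V i → (∀ z, y < z → z ∈ V i) → y ∈ V j) →
      ∃ W : Fin (n + 2) → Finset α, (∀ i, IsUpperSet (W i : Set α)) ∧
        (∀ i j, i ≠ j → ∀ y, y ∉ W i → (∀ z, y < z → z ∈ W i) → y ∈ W j) ∧
        (∀ i, ∀ y ∈ W i, (∀ z, z < y → z ∉ W i) → ∃ j, j ≠ i ∧ y ∉ W j) ∧
        sahiE μ (n + 2) (fun i => setInd (W i)) ≤ sahiE μ (n + 2) (fun i => setInd (V i)) from H _ V rfl hV hsat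
  intro m
  induction m using Nat.strong_induction_on with
  | _ m ih =>
    intro V hm hV hsat
    by_cases hco : ∀ i, ∀ y ∈ V i, (∀ z, z < y → z ∉ V i) → ∃ j, j ≠ i ∧ y ∉ V j
    · exact ⟨V, hV, hsat, hco, le_rfl⟩
    push Not at hco
    obtain ⟨i, y, hyi, hmin, hall⟩ := hco
    set V' : Fin (n + 2) → Finset α := update V i ((V i).erase y) with hV'
    have hV'i : V' i = (V i).erase y := by rw [hV', update_self]
    have hV'k : ∀ k, k ≠ i → V' k = V k := fun k hk => by rw [hV', update_of_ne hk]
    have hup : ∀ k, IsUpperSet (V' k : Set α) := by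
      intro k
      by_cases hk : k = i
      · subst hk; rw [hV'i]; exact isUpperSet_erase_of_minimal (V k) (hV k) hmin
      · rw [hV'k k hk]; exact hV k
    have hsat' := saturated_update_erase V hsat i hyi hmin (fun j hj => hall j hj)
    have hcard : ∑ k, (V' k).card + 1 = ∑ k, (V k).card := by
      have h1 : ∑ k, (V k).card = ∑ k, ((V' k).card + if k = i then 1 else 0) := by
        refine sum_congr rfl fun k _ => ?_
        by_cases hk : k = i
        · subst hk; rw [hV'i, if_pos rfl, card_erase_add_one hyi]
        · rw [hV'k k hk, if_neg hk, add_zero]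
      rw [h1, sum_add_distrib, sum_ite_eq' univ i, if_pos (mem_univ _)]
    have hm' : ∑ k, (V' k).card < m := by omega
    obtain ⟨W, hW, hWsat, hWco, hWle⟩ := ih _ hm' V' rfl hup hsat'
    refine ⟨W, hW, hWsat, hWco, hWle.trans ?_⟩
    rw [hV']
    exact sahiE_update_erase_le hμ0 hμ1 V i hyi (fun j hj => hall j hj)

/-- **THE DOUBLE NORMAL FORM** (every weight `μ ≥ 0` of mass one, given `C_k(μ)` for `k ≤ n+1`): every family of `n+2` up-sets is dominated — no larger
`E_{n+2}` — by a family of up-sets that is SATURATED (every maximal non-element of a member lies in all other members) and CO-SATURATED (no minimal element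
of a member lies in all other members). [this work] -/
theorem exists_biSaturated_le (hμ0 : ∀ x, 0 ≤ μ x) (hμ1 : ∑ x, μ x = 1) (hpos : ∀ k, 1 ≤ k → k ≤ n + 1 → SahiPositive μ k)
    (U : Fin (n + 2) → Finset α) (hU : ∀ i, IsUpperSet (U i : Set α)) :
    ∃ W : Fin (n + 2) → Finset α, (∀ i, IsUpperSet (W i : Set α)) ∧
      (∀ i j, i ≠ j → ∀ y, y ∉ W i → (∀ z, y < z → z ∈ W i) → y ∈ W j) ∧
      (∀ i, ∀ y ∈ W i, (∀ z, z < y → z ∉ W i) → ∃ j, j ≠ i ∧ y ∉ W j) ∧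
      sahiE μ (n + 2) (fun i => setInd (W i)) ≤ sahiE μ (n + 2) (fun i => setInd (U i)) := by
  obtain ⟨V, hV, -, hVsat, hVle⟩ := exists_saturated_le hμ0 hpos U hU
  obtain ⟨W, hW, hWsat, hWco, hWle⟩ := exists_coSaturated_le_of_saturated hμ0 hμ1 V hV hVsat
  exact ⟨W, hW, hWsat, hWco, hWle.trans hVle⟩

/-- **`C_{n+2}(μ)` from `C_{≤ n+1}(μ)` and positivity on BI-SATURATED families of up-sets.** [this work] -/
theorem sahiPositive_of_biSaturated (hμ0 : ∀ x, 0 ≤ μ x) (hμ1 : ∑ x, μ x = 1) (hpos : ∀ k, 1 ≤ k → k ≤ n + 1 → SahiPositive μ k)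
    (h : ∀ W : Fin (n + 2) → Finset α, (∀ i, IsUpperSet (W i : Set α)) →
      (∀ i j, i ≠ j → ∀ y, y ∉ W i → (∀ z, y < z → z ∈ W i) → y ∈ W j) →
      (∀ i, ∀ y ∈ W i, (∀ z, z < y → z ∉ W i) → ∃ j, j ≠ i ∧ y ∉ W j) → 0 ≤ sahiE μ (n + 2) (fun i => setInd (W i))) :
    SahiPositive μ (n + 2) := by
  rw [sahiPositive_iff_indicators]
  intro U hU
  obtain ⟨W, hW, hWsat, hWco, hle⟩ := exists_biSaturated_le hμ0 hμ1 hpos U hU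
  exact (h W hW hWsat hWco).trans hle

/-- **COLOURED ANTICHAINS WITH THE CO-SATURATION CONSTRAINT**: `C_{n+2}(μ)` follows from `C_{≤ n+1}(μ)` and `E_{n+2} ≥ 0` on the families
`U_i = {q | ∀ p ∈ N, c p = i → ¬ q ≤ p}`, `N ⊆ α` an antichain, `c : α → Fin (n+2)`, in which EVERY MINIMAL ELEMENT OF `U_i` LIES BELOW A POINT OF `N` OF
ANOTHER COLOUR. [this work] -/
theorem sahiPositive_of_colouring₂ (hμ0 : ∀ x, 0 ≤ μ x) (hμ1 : ∑ x, μ x = 1) (hpos : ∀ k, 1 ≤ k → k ≤ n + 1 → SahiPositive μ k)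
    (h : ∀ (N : Finset α) (c : α → Fin (n + 2)), IsAntichain (· ≤ ·) (N : Set α) →
      (∀ (i : Fin (n + 2)) (q : α), (∀ p ∈ N, c p = i → ¬ q ≤ p) →
        (∀ z, z < q → ∃ p ∈ N, c p = i ∧ z ≤ p) → ∃ p ∈ N, c p ≠ i ∧ q ≤ p) →
      0 ≤ sahiE μ (n + 2) (fun i => setInd (univ.filter fun q : α => ∀ p ∈ N, c p = i → ¬ q ≤ p))) :
    SahiPositive μ (n + 2) := by
  refine sahiPositive_of_biSaturated hμ0 hμ1 hpos fun V hV hsat hco => ?_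
  -- the coloured antichain of the maximal non-elements, as in `sahiPositive_of_colouring`
  set N : Finset α := univ.filter fun p => ∃ i, p ∉ V i ∧ ∀ z, p < z → z ∈ V i with hN
  have hc : ∀ p : α, ∃ i : Fin (n + 2), (p ∈ N → p ∉ V i ∧ ∀ z, p < z → z ∈ V i) := by
    intro p
    by_cases hp : p ∈ N
    · rw [hN, mem_filter] at hp
      obtain ⟨i, hi⟩ := hp.2
      exact ⟨i, fun _ => hi⟩
    · exact ⟨0, fun h' => (hp h').elim⟩
  choose c hcspec using hc
  have huniq : ∀ {p : α} {i i' : Fin (n + 2)}, p ∉ V i → (∀ z, p < z → z ∈ V i) → p ∉ V i' → i = i' := by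
    intro p i i' hi himax hi'
    by_contra hne
    exact hi' (hsat i i' hne p hi himax)
  -- membership in the co-generated members is membership in `V`
  have hmem : ∀ i q, (∀ p ∈ N, c p = i → ¬ q ≤ p) ↔ q ∈ V i := by
    intro i q
    constructor
    · intro hq
      by_contra hqV
      obtain ⟨p, hqp, hpV, hpmax⟩ := exists_maximal_notMem_ge (V i) hqV
      have hpN : p ∈ N := by rw [hN, mem_filter]; exact ⟨mem_univ _, i, hpV, hpmax⟩
      exact hq p hpN (huniq (hcspec p hpN).1 (hcspec p hpN).2 hpV) hqp
    · intro hq p hpN hpi hqp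
      have hpV : p ∉ V (c p) := (hcspec p hpN).1
      rw [hpi] at hpV
      exact hpV (hV i hqp hq)
  have hVeq : (fun i => setInd (univ.filter fun q : α => ∀ p ∈ N, c p = i → ¬ q ≤ p)) = fun i => setInd (V i) := by
    funext i
    congr 1
    ext q
    rw [mem_filter]
    exact ⟨fun h => (hmem i q).1 h.2, fun h => ⟨mem_univ _, (hmem i q).2 h⟩⟩
  have hanti : IsAntichain (· ≤ ·) (N : Set α) := by
    intro p hp p' hp' hne hle
    rw [mem_coe] at hp hp'
    have h1 := hcspec p hp
    have h2 := hcspec p' hp'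
    have hlt : p < p' := lt_of_le_of_ne hle hne
    by_cases hcc : c p = c p'
    · have : p' ∈ V (c p) := h1.2 p' hlt
      rw [hcc] at this
      exact h2.1 this
    · exact h2.1 (hV (c p') hle (hsat (c p) (c p') hcc p h1.1 h1.2))
  -- the co-saturation constraint in coloured form
  have hco' : ∀ (i : Fin (n + 2)) (q : α), (∀ p ∈ N, c p = i → ¬ q ≤ p) →
      (∀ z, z < q → ∃ p ∈ N, c p = i ∧ z ≤ p) → ∃ p ∈ N, c p ≠ i ∧ q ≤ p := by
    intro i q hq hqmin
    have hqV : q ∈ V i := (hmem i q).1 hq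
    have hmin : ∀ z, z < q → z ∉ V i := by
      intro z hz hzV
      obtain ⟨p, hpN, hpi, hzp⟩ := hqmin z hz
      exact ((hmem i z).2 hzV) p hpN hpi hzp
    obtain ⟨j, hji, hqj⟩ := hco i q hqV hmin
    obtain ⟨p, hqp, hpV, hpmax⟩ := exists_maximal_notMem_ge (V j) hqj
    have hpN : p ∈ N := by rw [hN, mem_filter]; exact ⟨mem_univ _, j, hpV, hpmax⟩
    refine ⟨p, hpN, ?_, hqp⟩
    rw [huniq (hcspec p hpN).1 (hcspec p hpN).2 hpV]
    exact hji
  have := h N c hanti hco'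
  rwa [hVeq] at this

/-- **Order 3, every FKG weight, unconditionally**: Sahi's `C_3` (Kahn's Conjecture 5 for a product measure) is decided on the triples co-generated by a
3-coloured antichain in which every minimal element of each member lies below an antichain point of another colour. [this work] -/
theorem sahiPositive_three_of_colouring₂ {α : Type*} [Fintype α] [DistribLattice α] {μ : α → ℝ} (hμ : IsFKGMeasure μ)
    (h : ∀ (N : Finset α) (c : α → Fin 3), IsAntichain (· ≤ ·) (N : Set α) →
      (∀ (i : Fin 3) (q : α), (∀ p ∈ N, c p = i → ¬ q ≤ p) →
        (∀ z, z < q → ∃ p ∈ N, c p = i ∧ z ≤ p) → ∃ p ∈ N, c p ≠ i ∧ q ≤ p) →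
      0 ≤ sahiE μ 3 (fun i => setInd (univ.filter fun q : α => ∀ p ∈ N, c p = i → ¬ q ≤ p))) :
    SahiPositive μ 3 := by
  refine sahiPositive_of_colouring₂ (n := 1) hμ.nonneg hμ.sum_eq_one (fun k hk1 hk2 => ?_) h
  interval_cases k
  · exact sahiPositive_one hμ.nonneg
  · exact sahiPositive_two hμ

end BiSaturation

end SahiAbsorbed

end Summit.CriticalPhenomena.PercolationContinuityZ3.Theorems
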